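import Literature.MathematicalPhysics.KineticTheory.HardSphereEuler
import Literature.Analysis.FluidPDE.MVWeakStrongUniqueness
import Summits.AtomisticToContinuum.HydrodynamicLimit.Theses.JParityClosure
import HarnessLib

/-!
# JParityClosure / ParityInBand — helper: the hard-sphere ↔ general-EOS bridge for step (iv)

Step (iv) of the intended proof of
`Summit.AtomisticToContinuum.HydrodynamicLimit.Theses.JParityClosure.ParityInBand` runs the
Březina–Feireisl weak(mv)–strong uniqueness theorem
(`Literature.Analysis.FluidPDE.CompressibleEuler.brezinaFeireisl2018_thm_3_3`, proved in the tree as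
`…_holds`) for the hard-sphere equation of state. That fact is stated for classical solutions
`IsClassicalEulerSolution eos T ρ u ϑ` of the complete Euler system with a general `eos : EulerEOS`;
the conjunct's hypotheses deliver `IsHardSphereEulerSolution σ T ρ u θ`. This file records the
unfolding bridge between the two (the hard-sphere law is the monatomic gas with excess free energy
`χ ρ = hsCompressibility (ρσ³)`, `f ρ = hsExcessFreeEnergy (ρσ³)`), in both directions.
-/

namespace Summit.AtomisticToContinuum.HydrodynamicLimit.Theorems

open Literature.MathematicalPhysics.KineticTheory Literature.Analysis.FluidPDE
open Literature.Analysis.FluidPDE.CompressibleEuler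

/-- The hard-sphere pressure law `hsPressure σ ρ ϑ = ρ ϑ Z(ρσ³)` IS the pressure of the complete
equation of state `EulerEOS.monatomicExcess χ f` with `χ ρ = hsCompressibility (ρσ³)`,
`f ρ = hsExcessFreeEnergy (ρσ³)` (monatomic gas with excess free energy: internal energy `3ϑ/2`,
entropy `3/2 log ϑ - log ρ - f ρ`) — definitionally. [folklore] -/
theorem hsPressure_eq_monatomicExcess_p (σ ρ ϑ : ℝ) :
    hsPressure σ ρ ϑ =
      (EulerEOS.monatomicExcess (fun r => hsCompressibility (r * σ ^ 3))
        (fun r => hsExcessFreeEnergy (r * σ ^ 3))).p ρ ϑ := rfl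

/-- The total energy density of the hard-sphere gas is the complete-Euler energy
`ρ(|u|²/2 + e(ρ,ϑ))` of the monatomic-excess equation of state (`e = 3ϑ/2`). [folklore] -/
theorem totalEnergyDensity_eq_monatomicExcess (σ ρ ϑ : ℝ) (u : V3) :
    totalEnergyDensity ρ u ϑ =
      ρ * (‖u‖ ^ 2 / 2 + (EulerEOS.monatomicExcess (fun r => hsCompressibility (r * σ ^ 3))
        (fun r => hsExcessFreeEnergy (r * σ ^ 3))).e ρ ϑ) := rfl

/-- **Bridge (hard spheres → general EOS).** A classical solution of the hard-sphere compressible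
Euler system on `[0,T) × 𝕋³` is a classical solution of the complete Euler system for the
monatomic-excess equation of state `χ ρ = hsCompressibility (ρσ³)`, `f ρ = hsExcessFreeEnergy (ρσ³)`
— field for field the same structure (unfolding). This is the form consumed by
`brezinaFeireisl2018_thm_3_3` in step (iv) of `ParityInBand`. [folklore] -/
theorem isClassicalEulerSolution_of_isHardSphereEulerSolution {σ T : ℝ} {ρ θ : ℝ → T3 → ℝ}
    {u : ℝ → T3 → V3} (h : IsHardSphereEulerSolution σ T ρ u θ) :
    IsClassicalEulerSolution
      (EulerEOS.monatomicExcess (fun r => hsCompressibility (r * σ ^ 3))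
        (fun r => hsExcessFreeEnergy (r * σ ^ 3))) T ρ u θ where
  smooth_density := h.smooth_density
  smooth_velocity := h.smooth_velocity
  smooth_temperature := h.smooth_temperature
  density_pos := h.density_pos
  temperature_pos := h.temperature_pos
  mass := h.mass
  momentum := h.momentum
  energy := h.energy

/-- **Bridge (general EOS → hard spheres).** Conversely, a classical solution of the complete Euler
system for the hard-sphere monatomic-excess equation of state is a hard-sphere Euler solution.
[folklore] -/
theorem isHardSphereEulerSolution_of_isClassicalEulerSolution {σ T : ℝ} {ρ θ : ℝ → T3 → ℝ}
    {u : ℝ → T3 → V3}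
    (h : IsClassicalEulerSolution
      (EulerEOS.monatomicExcess (fun r => hsCompressibility (r * σ ^ 3))
        (fun r => hsExcessFreeEnergy (r * σ ^ 3))) T ρ u θ) :
    IsHardSphereEulerSolution σ T ρ u θ where
  smooth_density := h.smooth_density
  smooth_velocity := h.smooth_velocity
  smooth_temperature := h.smooth_temperature
  density_pos := h.density_pos
  temperature_pos := h.temperature_pos
  mass := h.mass
  momentum := h.momentum
  energy := h.energy

/-- **Changing the equation of state off the solution's range.** If two complete equations of state
have the same pressure and the same internal energy at every state `(ρ(t,x), ϑ(t,x))`,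
`t ∈ [0,T)`, visited by a classical solution for the first, then it is a classical solution for the
second (the Euler system only evaluates `p`, `e` along the solution; the one-sided time derivative
within `[0,T)` and the space derivatives only see these values). This is what lets step (iv) of
`ParityInBand` run BF18 with a globally `C²`/Gibbs/stable MODIFICATION of the hard-sphere law that
agrees with it in the packing band, where `DensityCap` keeps the solution. [folklore] -/
theorem isClassicalEulerSolution_congr_eos {eos eos' : EulerEOS} {T : ℝ} {ρ ϑ : ℝ → T3 → ℝ}
    {u : ℝ → T3 → V3} (h : IsClassicalEulerSolution eos T ρ u ϑ)
    (hp : ∀ t ∈ Set.Ico 0 T, ∀ x, eos'.p (ρ t x) (ϑ t x) = eos.p (ρ t x) (ϑ t x))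
    (he : ∀ t ∈ Set.Ico 0 T, ∀ x, eos'.e (ρ t x) (ϑ t x) = eos.e (ρ t x) (ϑ t x)) :
    IsClassicalEulerSolution eos' T ρ u ϑ where
  smooth_density := h.smooth_density
  smooth_velocity := h.smooth_velocity
  smooth_temperature := h.smooth_temperature
  density_pos := h.density_pos
  temperature_pos := h.temperature_pos
  mass := h.mass
  momentum t ht x := by
    have hfun : (fun y => eos'.p (ρ t y) (ϑ t y)) = fun y => eos.p (ρ t y) (ϑ t y) :=
      funext fun y => hp t ht y
    rw [hfun]
    exact h.momentum t ht x
  energy t ht x := by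
    have hE : ∀ s ∈ Set.Ico 0 T, (fun y => ρ s y * (‖u s y‖ ^ 2 / 2 + eos'.e (ρ s y) (ϑ s y))) =
        fun y => ρ s y * (‖u s y‖ ^ 2 / 2 + eos.e (ρ s y) (ϑ s y)) :=
      fun s hs => funext fun y => by rw [he s hs y]
    have htd : Literature.Analysis.FunctionSpaces.Torus.timeDerivWithin (Set.Ico 0 T)
          (fun s y => ρ s y * (‖u s y‖ ^ 2 / 2 + eos'.e (ρ s y) (ϑ s y))) t x =
        Literature.Analysis.FunctionSpaces.Torus.timeDerivWithin (Set.Ico 0 T)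
          (fun s y => ρ s y * (‖u s y‖ ^ 2 / 2 + eos.e (ρ s y) (ϑ s y))) t x := by
      unfold Literature.Analysis.FunctionSpaces.Torus.timeDerivWithin
      refine derivWithin_congr (fun s hs => ?_) ?_
      · simp only [he s hs x]
      · simp only [he t ht x]
    have hdiv : (fun y => (ρ t y * (‖u t y‖ ^ 2 / 2 + eos'.e (ρ t y) (ϑ t y)) +
          eos'.p (ρ t y) (ϑ t y)) • u t y) =
        fun y => (ρ t y * (‖u t y‖ ^ 2 / 2 + eos.e (ρ t y) (ϑ t y)) + eos.p (ρ t y) (ϑ t y)) • u t y :=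
      funext fun y => by rw [he t ht y, hp t ht y]
    rw [htd, hdiv]
    exact h.energy t ht x

/-- **Hard-sphere solutions for a band-modified equation of state.** If `eos'` has the hard-sphere
pressure `hsPressure σ` and the athermal internal energy `3ϑ/2` on a set `S` of states containing
every `(ρ(t,x), θ(t,x))`, `t ∈ [0,T)`, of a classical hard-sphere Euler solution, then that solution
is a classical solution of the complete Euler system for `eos'` — the form in which step (iv) feeds
`brezinaFeireisl2018_thm_3_3` (take `S = {ρσ³ < η₀} ∩ {ρ, ϑ > 0}` and `eos'` a global
`C²`/Gibbs/stable extension of the hard-sphere law off the band). [folklore] -/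
theorem isClassicalEulerSolution_of_isHardSphereEulerSolution_of_eqOn {σ T : ℝ} {ρ θ : ℝ → T3 → ℝ}
    {u : ℝ → T3 → V3} (h : IsHardSphereEulerSolution σ T ρ u θ) {eos' : EulerEOS} {S : Set (ℝ × ℝ)}
    (hS : ∀ t ∈ Set.Ico 0 T, ∀ x, (ρ t x, θ t x) ∈ S)
    (hp : ∀ q ∈ S, eos'.p q.1 q.2 = hsPressure σ q.1 q.2)
    (he : ∀ q ∈ S, eos'.e q.1 q.2 = 3 / 2 * q.2) :
    IsClassicalEulerSolution eos' T ρ u θ :=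
  isClassicalEulerSolution_congr_eos (isClassicalEulerSolution_of_isHardSphereEulerSolution h)
    (fun t ht x => hp _ (hS t ht x)) (fun t ht x => he _ (hS t ht x))

/-- The two solution notions coincide for the hard-sphere law (unfolding). [folklore] -/
theorem isHardSphereEulerSolution_iff_isClassicalEulerSolution {σ T : ℝ} {ρ θ : ℝ → T3 → ℝ}
    {u : ℝ → T3 → V3} :
    IsHardSphereEulerSolution σ T ρ u θ ↔
      IsClassicalEulerSolution
        (EulerEOS.monatomicExcess (fun r => hsCompressibility (r * σ ^ 3))
          (fun r => hsExcessFreeEnergy (r * σ ^ 3))) T ρ u θ :=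
  ⟨isClassicalEulerSolution_of_isHardSphereEulerSolution,
    isHardSphereEulerSolution_of_isClassicalEulerSolution⟩

end Summit.AtomisticToContinuum.HydrodynamicLimit.Theorems
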